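import Mathlib
import HarnessLib

/-!
# `Balaban1983to89.B1Eq324BenfattoClassAppendixCLemma1` — LEMMA 1 OF APPENDIX C of [BenfattoEtAl1978] (Commun. Math. Phys. **59**
# (1978) 143–166), (C.9) p. 165, WITHOUT the positivity hypothesis «C_ij > 0»: `‖C‖ := sup_i Σ_j |C_ij|` — PROVED

statement-level skeleton of published theorems with citation tags; proofs where landed; nothing here is a claim about the
Yang–Mills mass gap

WHY THIS MODULE (cell `pub-ymgap`, seat `dag-n08-b` gen 7; sequel of `B1Eq324BenfattoClassAppendixC`, the CLASS form of Appendix C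
for Gaussian vectors with elliptic, exponentially decaying precision).  The §5 road of [BenfattoEtAl1978] uses Lemma 1 of Appendix C
(«The replacement of the χ′_s by 1 is a trivial consequence of point 2) and Lemma 1 of Appendix C», App. D p. 165); the tree proves
it AS PRINTED (`B1Eq324BenfattoAppendixC.appC_lemma1`, on `Fin n`, hypothesis `0 ≤ C i j`).  A general elliptic precision has a
covariance of BOTH signs, so the class form needs the lemma without positivity: the printed proof uses `C_ij ≥ 0` only in the step
`Σ_{ij} εᵢεⱼbᵢbⱼC_ij ≤ ‖C‖Σbᵢ²`, which survives with `|C_ij|` and `‖C‖ := sup_i Σ_j |C_ij|`.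

THE PRINTED TEXT (p. 165, verbatim): *"**Lemma 1.** Given n gaussian variables {z_i}_{i=1}^{n} with covariance C_ij > 0, i, j = 1,…,n
and given b₁,…,b_n > 0:* `∫ Π_{i=1}^{n} χ(|z_i| > b_i) dP ≦ exp[−Σ_{i=1}^{n} (b_i²/(2‖C‖) − log 2)]` *(C.9) where*
`‖C‖ = sup_i Σ_{j=1}^{n} C_ij`. *Proof. If γ > 0: … ≦ exp[½Σ_{i,j} γ²b_ib_jC_ij]. Hence … ≦ exp[−γ(1 − (γ/2)‖C‖)Σ_i b_i²] and the
lemma follows by choosing γ = 1/‖C‖."*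

DICTIONARY.  «n gaussian variables with covariance C» ↦ Mathlib's centred `multivariateGaussian 0 C` on `EuclideanSpace ℝ ι` for a
finite index type `ι` (coordinates `x i`), `C.PosSemidef`; «Π_i χ(|z_i| > b_i)» ↦ the event `{x | ∀ i, b i < |x i|}`;
`‖C‖ := ⨆ i, ∑ j, |C i j|` (inlined).

WHAT IS PROVED (no definition, no named fact, no `sorry`; axioms standard): `measureReal_forall_lt_abs_le_exp` — (C.9) with
`‖C‖ := sup_i Σ_j |C_ij|`, for every `C ⪰ 0` and `bᵢ > 0`, along print's route (tilt by `γ = 1/‖C‖` on each of the `2^{|ι|}` sign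
patterns, Gaussian moment generating function via `IsGaussian.map_eq_gaussianReal` + `covarianceBilin_multivariateGaussian`, Chernoff
`measure_ge_le_exp_mul_mgf`, union bound); private steps `quadForm_sign_le_abs`, `measureReal_signEvent_le_abs`.

HONEST SCOPE.  A probability lemma about Gaussian vectors; nothing of [Balaban1985UV3] asserted; count-neutral for N08; nothing
continuum / OS / mass-gap / Clay.
-/

noncomputable section

open Finset Matrix
open scoped BigOperators

namespace Literature.MathematicalPhysics.QuantumFieldTheory.Balaban1983to89.B1Eq324BenfattoClassAppendixCLemma1

variable {ι : Type*} [Fintype ι] [DecidableEq ι]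

/-! ## Lemma 1 of Appendix C, (C.9), WITHOUT the positivity «C_ij > 0»: `‖C‖ := sup_i Σ_j |C_ij|` -/

section Lemma1Abs

open MeasureTheory ProbabilityTheory WithLp
open scoped InnerProductSpace

omit [DecidableEq ι] in
/-- `⟪(εᵢbᵢ)ᵢ, x⟫ = Σᵢ εᵢ bᵢ xᵢ` on `EuclideanSpace ℝ ι`. [folklore] -/
private theorem inner_toLp_mul (ε b : ι → ℝ) (x : EuclideanSpace ℝ ι) :
    ⟪toLp 2 (fun i => ε i * b i), x⟫_ℝ = ∑ i, ε i * b i * x i := by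
  rw [PiLp.inner_apply]
  refine Finset.sum_congr rfl fun i _ => ?_
  rw [show toLp 2 (fun i => ε i * b i) i = ε i * b i from rfl]
  simp only [RCLike.inner_apply, conj_trivial]
  ring

omit [DecidableEq ι] in
/-- The quadratic-form step WITHOUT positivity: `Σ_{ij} (εᵢbᵢ)(εⱼbⱼ)C_ij ≤ Σ_{ij} bᵢ|C_ij|bⱼ ≤ N Σᵢ bᵢ²` for `C` symmetric,
`bᵢ ≥ 0`, `Σⱼ |C_ij| ≤ N`. [cite: BenfattoEtAl1978, Appendix C Lemma 1 proof p.165 (class form)] -/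
private theorem quadForm_sign_le_abs {C : Matrix ι ι ℝ} (hsymm : ∀ i j, C i j = C j i)
    {b : ι → ℝ} (hb : ∀ i, 0 ≤ b i) {N : ℝ} (hrow : ∀ i, ∑ j, |C i j| ≤ N)
    {ε : ι → ℝ} (hε : ∀ i, |ε i| = 1) :
    ∑ i, ∑ j, (ε i * b i) * C i j * (ε j * b j) ≤ N * ∑ i, b i ^ 2 := by
  -- drop the signs, take absolute values of the entries
  have h1 : ∑ i, ∑ j, (ε i * b i) * C i j * (ε j * b j) ≤ ∑ i, ∑ j, b i * |C i j| * b j := by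
    refine Finset.sum_le_sum fun i _ => Finset.sum_le_sum fun j _ => ?_
    have habs : |(ε i * b i) * C i j * (ε j * b j)| = b i * |C i j| * b j := by
      rw [abs_mul, abs_mul, abs_mul, abs_mul, hε i, hε j, abs_of_nonneg (hb i), abs_of_nonneg (hb j)]
      ring
    exact (le_abs_self _).trans habs.le
  -- AM–GM and symmetry
  have h2 : ∑ i, ∑ j, b i * |C i j| * b j ≤ ∑ i, ∑ j, |C i j| * (b i ^ 2 + b j ^ 2) / 2 := by
    refine Finset.sum_le_sum fun i _ => Finset.sum_le_sum fun j _ => ?_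
    nlinarith [sq_nonneg (b i - b j), abs_nonneg (C i j)]
  have h3 : ∑ i, ∑ j, |C i j| * (b i ^ 2 + b j ^ 2) / 2 =
      (∑ i, b i ^ 2 * ∑ j, |C i j|) / 2 + (∑ j, b j ^ 2 * ∑ i, |C i j|) / 2 := by
    have hA : ∑ i, ∑ j, |C i j| * (b i ^ 2 + b j ^ 2) / 2 =
        ∑ i, ∑ j, (|C i j| * b i ^ 2 / 2 + |C i j| * b j ^ 2 / 2) := by
      refine Finset.sum_congr rfl fun i _ => Finset.sum_congr rfl fun j _ => ?_
      ring
    rw [hA]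
    simp only [Finset.sum_add_distrib]
    congr 1
    · rw [Finset.sum_div]
      refine Finset.sum_congr rfl fun i _ => ?_
      rw [Finset.mul_sum, Finset.sum_div]
      refine Finset.sum_congr rfl fun j _ => ?_
      ring
    · rw [Finset.sum_comm, Finset.sum_div]
      refine Finset.sum_congr rfl fun j _ => ?_
      rw [Finset.mul_sum, Finset.sum_div]
      refine Finset.sum_congr rfl fun i _ => ?_
      ring
  have h4 : ∑ i, b i ^ 2 * ∑ j, |C i j| ≤ N * ∑ i, b i ^ 2 := by
    rw [Finset.mul_sum]
    refine Finset.sum_le_sum fun i _ => ?_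
    rw [mul_comm N]
    exact mul_le_mul_of_nonneg_left (hrow i) (sq_nonneg _)
  have h5 : ∑ j, b j ^ 2 * ∑ i, |C i j| ≤ N * ∑ i, b i ^ 2 := by
    have : ∑ j, b j ^ 2 * ∑ i, |C i j| = ∑ j, b j ^ 2 * ∑ i, |C j i| := by
      refine Finset.sum_congr rfl fun j _ => ?_
      congr 1
      exact Finset.sum_congr rfl fun i _ => by rw [hsymm i j]
    rw [this]
    exact h4
  linarith

variable (C : Matrix ι ι ℝ)

/-- One sign pattern at the tilt `γ = 1/‖C‖`: for `C ⪰ 0`, `bᵢ > 0`, absolute row sums `≤ N` with `N > 0`,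
`P(εᵢxᵢ > bᵢ ∀ i) ≤ exp(−Σbᵢ²/(2N))`. [cite: BenfattoEtAl1978, Appendix C Lemma 1 proof p.165 (class form)] -/
private theorem measureReal_signEvent_le_abs (hC : C.PosSemidef) {b : ι → ℝ}
    (hb : ∀ i, 0 < b i) {N : ℝ} (hN : 0 < N) (hrow : ∀ i, ∑ j, |C i j| ≤ N) {ε : ι → ℝ} (hε : ∀ i, |ε i| = 1) :
    (multivariateGaussian 0 C).real {x | ∀ i, b i < ε i * x i} ≤
      Real.exp (-((∑ i, b i ^ 2) / (2 * N))) := by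
  set P := multivariateGaussian 0 C with hP
  set w : EuclideanSpace ℝ ι := toLp 2 (fun i => ε i * b i) with hw
  set L : StrongDual ℝ (EuclideanSpace ℝ ι) := innerSL ℝ w with hL
  have hLapply : ∀ x, L x = ⟪w, x⟫_ℝ := fun x => rfl
  -- the law of the tilt functional
  have hmap := IsGaussian.map_eq_gaussianReal (μ := P) L
  have hmean : P[L] = 0 := by
    rw [ContinuousLinearMap.integral_comp_id_comm, hP, integral_id_multivariateGaussian, map_zero]
    exact IsGaussian.integrable_id
  have hvar : Var[L; P] = w ⬝ᵥ C *ᵥ w := by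
    rw [← covarianceBilin_multivariateGaussian hC w w, covarianceBilin_self IsGaussian.memLp_two_id]
    rfl
  rw [hmean] at hmap
  -- the quadratic form `w ⬝ᵥ C w ≤ N Σ b²`
  have hquad : w ⬝ᵥ C *ᵥ w ≤ N * ∑ i, b i ^ 2 := by
    have hexp : w ⬝ᵥ C *ᵥ w = ∑ i, ∑ j, (ε i * b i) * C i j * (ε j * b j) := by
      simp only [dotProduct, Matrix.mulVec, Finset.mul_sum, hw]
      refine Finset.sum_congr rfl fun i _ => Finset.sum_congr rfl fun j _ => ?_
      ring
    rw [hexp]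
    exact quadForm_sign_le_abs (fun i j => by simpa using (hC.isHermitian.apply i j).symm)
      (fun i => (hb i).le) hrow hε
  have hvar_le : ((Var[L; P]).toNNReal : ℝ) ≤ N * ∑ i, b i ^ 2 := by
    rw [Real.coe_toNNReal', hvar]
    exact max_le hquad (by positivity)
  -- Chernoff
  set γ : ℝ := 1 / N with hγ
  have hγ0 : 0 ≤ γ := by positivity
  have hint : Integrable (fun x => Real.exp (γ * L x)) P := by
    have h1 : Integrable (fun y : ℝ => Real.exp (γ * y)) (P.map L) := by
      rw [hmap]
      exact integrable_exp_mul_gaussianReal γ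
    exact (integrable_map_measure (by fun_prop) L.continuous.measurable.aemeasurable).1 h1
  have hcher := measure_ge_le_exp_mul_mgf (μ := P) (X := fun x => L x) (∑ i, b i ^ 2) hγ0 hint
  have hmgf : mgf (fun x => L x) P γ = Real.exp (0 * γ + ((Var[L; P]).toNNReal : ℝ) * γ ^ 2 / 2) :=
    mgf_gaussianReal hmap γ
  -- the event inclusion `{εx > b} ⊆ {Σb² ≤ L x}`
  have hsub : {x : EuclideanSpace ℝ ι | ∀ i, b i < ε i * x i} ⊆ {x | ∑ i, b i ^ 2 ≤ L x} := by
    intro x hx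
    simp only [Set.mem_setOf_eq] at hx ⊢
    rw [hLapply, hw, inner_toLp_mul]
    refine Finset.sum_le_sum fun i _ => ?_
    have := mul_le_mul_of_nonneg_left (hx i).le (hb i).le
    nlinarith
  calc P.real {x | ∀ i, b i < ε i * x i} ≤ P.real {x | ∑ i, b i ^ 2 ≤ L x} :=
        measureReal_mono hsub (measure_ne_top _ _)
    _ ≤ Real.exp (-γ * ∑ i, b i ^ 2) * mgf (fun x => L x) P γ := hcher
    _ = Real.exp (-γ * ∑ i, b i ^ 2 + ((Var[L; P]).toNNReal : ℝ) * γ ^ 2 / 2) := by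
        rw [hmgf, ← Real.exp_add]
        ring_nf
    _ ≤ Real.exp (-γ * ∑ i, b i ^ 2 + N * (∑ i, b i ^ 2) * γ ^ 2 / 2) := by
        refine Real.exp_le_exp.2 ?_
        have : ((Var[L; P]).toNNReal : ℝ) * γ ^ 2 / 2 ≤ N * (∑ i, b i ^ 2) * γ ^ 2 / 2 := by
          have hg2 : 0 ≤ γ ^ 2 / 2 := by positivity
          nlinarith [hvar_le]
        linarith
    _ = Real.exp (-((∑ i, b i ^ 2) / (2 * N))) := by
        congr 1
        rw [hγ]
        field_simp
        ring

/-- **(C.9) for the class — Lemma 1 of Appendix C WITHOUT «C_ij > 0»**: for a centred Gaussian vector with covariance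
`C ⪰ 0` on a finite index set and thresholds `bᵢ > 0`,
`P(|x_i| > b_i ∀ i) ≤ exp[−Σ_i (b_i²/(2‖C‖) − log 2)]` with `‖C‖ := sup_i Σ_j |C_ij|` — print's route (tilt by `γ = 1/‖C‖` on each
sign pattern, Gaussian moment generating function, union over the `2^{|ι|}` patterns), the positivity of print being used only through
`|Σ εᵢεⱼbᵢbⱼC_ij| ≤ Σ bᵢbⱼ|C_ij|`.  (The tree's `B1Eq324BenfattoAppendixC.appC_lemma1` is the printed positive case on `Fin n`.)
[cite: BenfattoEtAl1978, Appendix C Lemma 1 (C.9) p.165 (class form)] -/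
theorem measureReal_forall_lt_abs_le_exp (hC : C.PosSemidef) (b : ι → ℝ) (hb : ∀ i, 0 < b i) :
    (multivariateGaussian 0 C).real {x | ∀ i, b i < |x i|} ≤
      Real.exp (-(∑ i, (b i ^ 2 / (2 * ⨆ i, ∑ j, |C i j|) - Real.log 2))) := by
  classical
  set P := multivariateGaussian 0 C with hP
  set N : ℝ := ⨆ i, ∑ j, |C i j| with hN
  have hN0 : 0 ≤ N := Real.iSup_nonneg fun i => Finset.sum_nonneg fun j _ => abs_nonneg (C i j)
  have hrow : ∀ i, ∑ j, |C i j| ≤ N := fun i =>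
    le_ciSup (f := fun i => ∑ j, |C i j|) (Set.finite_range _).bddAbove i
  -- the right side is `2^{|ι|} · exp(−Σb²/(2N))`
  have hrhs : Real.exp (-(∑ i, (b i ^ 2 / (2 * N) - Real.log 2))) =
      (2 : ℝ) ^ Fintype.card ι * Real.exp (-((∑ i, b i ^ 2) / (2 * N))) := by
    have hs : ∑ i, (b i ^ 2 / (2 * N) - Real.log 2) = (∑ i, b i ^ 2) / (2 * N) - Fintype.card ι * Real.log 2 := by
      rw [Finset.sum_sub_distrib, Finset.sum_div, Finset.sum_const, Finset.card_univ, nsmul_eq_mul]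
    rw [hs, neg_sub, sub_eq_add_neg, Real.exp_add, Real.exp_nat_mul, Real.exp_log two_pos]
  rw [hrhs]
  have hPle : P.real {x | ∀ i, b i < |x i|} ≤ 1 := by
    calc P.real {x | ∀ i, b i < |x i|} ≤ P.real Set.univ := measureReal_mono (Set.subset_univ _) (measure_ne_top _ _)
      _ = 1 := probReal_univ
  rcases hN0.eq_or_lt with hN00 | hNpos
  · -- degenerate: `‖C‖ = 0`, the bound is `2^{|ι|} ≥ 1`
    rw [← hN00]
    simp only [mul_zero, div_zero, neg_zero, Real.exp_zero, mul_one]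
    exact hPle.trans (one_le_pow₀ (by norm_num))
  -- the union over sign patterns
  have hcover : {x : EuclideanSpace ℝ ι | ∀ i, b i < |x i|} ⊆
      ⋃ s : Finset ι, {x | ∀ i, b i < (if i ∈ s then (1 : ℝ) else -1) * x i} := by
    intro x hx
    simp only [Set.mem_setOf_eq] at hx
    refine Set.mem_iUnion.2 ⟨Finset.univ.filter fun i => 0 < x i, fun i => ?_⟩
    simp only [Finset.mem_filter, Finset.mem_univ, true_and]
    by_cases h : 0 < x i
    · rw [if_pos h, one_mul, ← abs_of_pos h]
      exact hx i
    · rw [if_neg h, neg_one_mul, ← abs_of_nonpos (not_lt.1 h)]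
      exact hx i
  have hε : ∀ (s : Finset ι) (i : ι), |(if i ∈ s then (1 : ℝ) else -1)| = 1 := by
    intro s i
    split_ifs <;> norm_num
  calc P.real {x | ∀ i, b i < |x i|}
      ≤ P.real (⋃ s : Finset ι, {x | ∀ i, b i < (if i ∈ s then (1 : ℝ) else -1) * x i}) :=
        measureReal_mono hcover (measure_ne_top _ _)
    _ ≤ ∑ s : Finset ι, P.real {x | ∀ i, b i < (if i ∈ s then (1 : ℝ) else -1) * x i} :=
        measureReal_iUnion_fintype_le _
    _ ≤ ∑ _s : Finset ι, Real.exp (-((∑ i, b i ^ 2) / (2 * N))) :=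
        Finset.sum_le_sum fun s _ => measureReal_signEvent_le_abs C hC hb hNpos hrow (hε s)
    _ = (2 : ℝ) ^ Fintype.card ι * Real.exp (-((∑ i, b i ^ 2) / (2 * N))) := by
        rw [Finset.sum_const, Finset.card_univ, Fintype.card_finset, nsmul_eq_mul]
        push_cast
        ring

end Lemma1Abs

end Literature.MathematicalPhysics.QuantumFieldTheory.Balaban1983to89.B1Eq324BenfattoClassAppendixCLemma1

end
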